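import Literature.Computability.AlgebraicComplexity.BI17TernaryQuarticUnipotentFixed
import HarnessLib

/-!
# Ternary quartics with a diagonal stabilizer element: support counts and charts

Theorem-only companion (cell `val-lit`, row BI2017-A; no definitions, no named facts) for the
dimension count "a generic ternary quartic has trivial stabilizer" (Bürgisser–Ikenmeyer 2017
Thm. 2.3 at `(D, m) = (4, 3)` as corrected, erratum A21; Poonen 2005 Thm. 3 at `(n, d) = (1, 4)`),
diagonal cases. If `diag(λ₀, λ₁, λ₂) · f = f` for a quartic `f` then `λ^e = 1` on the support
of `f`; two monomials differing by a unit transfer `x_i ↔ x_j` cannot both occur unless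
`λ_i = λ_j`. Covering the `15` quartic monomials by `6` cliques of the "unit transfer" graph
(three triangles and three edges) bounds the support by `6` when the `λ_i` are pairwise distinct
(`card_support_le_six_of_diagonal`); covering them by `6` edges in the directions `x₀ ↔ x₂`,
`x₁ ↔ x₂` and `3` singletons bounds it by `9` when `λ₀ = λ₁ ≠ λ₂`
(`card_support_le_nine_of_diagonal`). With the charts of the final file (one column of `P`
normalised by the torus, resp. two columns column-reduced by the centraliser `GL₂`) this gives
`6 + 8 = 14` and `9 + 5 = 14 < 15 = dim Sym⁴ ℂ³` parameters.

Honest framing: classical invariant-theory bookkeeping; nothing here bears on VP versus VNP.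

## References

* [BurgisserIkenmeyer2017] P. Bürgisser, C. Ikenmeyer, *Fundamental invariants of orbit closures*,
  J. Algebra 477 (2017) 390–434, §2.1 Thm. 2.3 and Appendix Prop. 7.5.
* [Poonen2005] B. Poonen, *Varieties without extra automorphisms III: hypersurfaces*, Finite
  Fields Appl. 11 (2005), Thm. 3.
-/

noncomputable section

open MvPolynomial
open scoped BigOperators

namespace Literature.Computability.AlgebraicComplexity

/-! ### §1 Diagonal substitutions and supports -/

section DiagonalSupport

/-- Coefficients of a diagonal substitution of a ternary form:
`coeff_e (diag(β) · f) = β₀^{e₀} β₁^{e₁} β₂^{e₂} coeff_e f`. [cite: BurgisserIkenmeyer2017, §7 (Appendix) Prop. 7.5] -/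
theorem coeff_linSubst_diagonal_fin_three (β : Fin 3 → ℂ) (f : MvPolynomial (Fin 3) ℂ)
    (e : Fin 3 →₀ ℕ) :
    coeff e (linSubst (Fin 3) ℂ (Matrix.diagonal β) f) =
      (β 0 ^ e 0 * β 1 ^ e 1 * β 2 ^ e 2) * coeff e f := by
  classical
  conv_lhs => rw [f.as_sum, map_sum]
  simp only [linSubst_diagonal_monomial, coeff_sum, coeff_smul, coeff_monomial, smul_eq_mul]
  rw [Finset.sum_eq_single e]
  · rw [if_pos rfl, Finsupp.prod_fintype _ _ (fun i => pow_zero _), Fin.prod_univ_three]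
  · intro e' _ hne
    rw [if_neg hne, mul_zero]
  · intro he
    rw [notMem_support_iff.mp he, if_pos rfl, mul_zero]

/-- **Diagonal stabilizer element ⇒ `λ^e = 1` on the support.** If `diag(λ₀, λ₁, λ₂) · f = f`
then every monomial `x^e` of `f` has `λ₀^{e₀} λ₁^{e₁} λ₂^{e₂} = 1`; for a quartic also
`e₀ + e₁ + e₂ = 4`. [cite: BurgisserIkenmeyer2017, §7 (Appendix) Prop. 7.5] -/
theorem pow_mul_pow_eq_one_of_diagonal {f : MvPolynomial (Fin 3) ℂ} {D : ℕ} (hf : f.IsHomogeneous D)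
    {l₀ l₁ l₂ : ℂ} (hT : linSubst (Fin 3) ℂ !![l₀, 0, 0; 0, l₁, 0; 0, 0, l₂] f = f)
    {e : Fin 3 →₀ ℕ} (he : e ∈ f.support) :
    l₀ ^ e 0 * l₁ ^ e 1 * l₂ ^ e 2 = 1 ∧ e 0 + e 1 + e 2 = D := by
  classical
  have hdiag : (!![l₀, 0, 0; 0, l₁, 0; 0, 0, l₂] : Matrix (Fin 3) (Fin 3) ℂ) =
      Matrix.diagonal ![l₀, l₁, l₂] := by
    ext i j; fin_cases i <;> fin_cases j <;> simp
  constructor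
  · have h := congrArg (coeff e) hT
    rw [hdiag, coeff_linSubst_diagonal_fin_three] at h
    have hc : coeff e f ≠ 0 := mem_support_iff.mp he
    have h2 := (mul_eq_right₀ hc).mp h
    simpa using h2
  · have hdeg : Finsupp.weight (1 : Fin 3 → ℕ) e = D := hf (mem_support_iff.mp he)
    rw [Finsupp.weight_apply, Finsupp.sum_fintype _ _ (fun _ => by simp)] at hdeg
    simpa [Fin.sum_univ_three] using hdeg

/-- Unit transfer `x₀ → x₁`: two such monomials in the support force `λ₀ = λ₁`. [cite: BurgisserIkenmeyer2017, §7 (Appendix) Prop. 7.5] -/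
theorem eq_of_transfer_zero_one {l₀ l₁ l₂ : ℂ} (h0 : l₀ ≠ 0) (h1 : l₁ ≠ 0) (h2 : l₂ ≠ 0)
    {a b c : ℕ} (h : l₀ ^ (a + 1) * l₁ ^ b * l₂ ^ c = 1) (h' : l₀ ^ a * l₁ ^ (b + 1) * l₂ ^ c = 1) :
    l₀ = l₁ := by
  have hne : l₀ ^ a * l₁ ^ b * l₂ ^ c ≠ 0 :=
    mul_ne_zero (mul_ne_zero (pow_ne_zero _ h0) (pow_ne_zero _ h1)) (pow_ne_zero _ h2)
  apply mul_left_cancel₀ hne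
  calc l₀ ^ a * l₁ ^ b * l₂ ^ c * l₀ = l₀ ^ (a + 1) * l₁ ^ b * l₂ ^ c := by ring
    _ = l₀ ^ a * l₁ ^ (b + 1) * l₂ ^ c := by rw [h, h']
    _ = l₀ ^ a * l₁ ^ b * l₂ ^ c * l₁ := by ring

/-- Unit transfer `x₀ → x₂`: two such monomials in the support force `λ₀ = λ₂`. [cite: BurgisserIkenmeyer2017, §7 (Appendix) Prop. 7.5] -/
theorem eq_of_transfer_zero_two {l₀ l₁ l₂ : ℂ} (h0 : l₀ ≠ 0) (h1 : l₁ ≠ 0) (h2 : l₂ ≠ 0)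
    {a b c : ℕ} (h : l₀ ^ (a + 1) * l₁ ^ b * l₂ ^ c = 1) (h' : l₀ ^ a * l₁ ^ b * l₂ ^ (c + 1) = 1) :
    l₀ = l₂ := by
  have hne : l₀ ^ a * l₁ ^ b * l₂ ^ c ≠ 0 :=
    mul_ne_zero (mul_ne_zero (pow_ne_zero _ h0) (pow_ne_zero _ h1)) (pow_ne_zero _ h2)
  apply mul_left_cancel₀ hne
  calc l₀ ^ a * l₁ ^ b * l₂ ^ c * l₀ = l₀ ^ (a + 1) * l₁ ^ b * l₂ ^ c := by ring
    _ = l₀ ^ a * l₁ ^ b * l₂ ^ (c + 1) := by rw [h, h']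
    _ = l₀ ^ a * l₁ ^ b * l₂ ^ c * l₂ := by ring

/-- Unit transfer `x₁ → x₂`: two such monomials in the support force `λ₁ = λ₂`. [cite: BurgisserIkenmeyer2017, §7 (Appendix) Prop. 7.5] -/
theorem eq_of_transfer_one_two {l₀ l₁ l₂ : ℂ} (h0 : l₀ ≠ 0) (h1 : l₁ ≠ 0) (h2 : l₂ ≠ 0)
    {a b c : ℕ} (h : l₀ ^ a * l₁ ^ (b + 1) * l₂ ^ c = 1) (h' : l₀ ^ a * l₁ ^ b * l₂ ^ (c + 1) = 1) :
    l₁ = l₂ := by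
  have hne : l₀ ^ a * l₁ ^ b * l₂ ^ c ≠ 0 :=
    mul_ne_zero (mul_ne_zero (pow_ne_zero _ h0) (pow_ne_zero _ h1)) (pow_ne_zero _ h2)
  apply mul_left_cancel₀ hne
  calc l₀ ^ a * l₁ ^ b * l₂ ^ c * l₁ = l₀ ^ a * l₁ ^ (b + 1) * l₂ ^ c := by ring
    _ = l₀ ^ a * l₁ ^ b * l₂ ^ (c + 1) := by rw [h, h']
    _ = l₀ ^ a * l₁ ^ b * l₂ ^ c * l₂ := by ring

/-- The support of a ternary quartic injects into `ℕ × ℕ` by `e ↦ (e₀, e₁)`; its image consists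
of pairs `(a, b)` with `a + b ≤ 4` satisfying any property the support satisfies.
[cite: BurgisserIkenmeyer2017, §7 (Appendix) Prop. 7.5] -/
theorem card_support_eq_card_image {f : MvPolynomial (Fin 3) ℂ} (hf : f.IsHomogeneous 4) :
    f.support.card = (f.support.image fun e : Fin 3 →₀ ℕ => (e 0, e 1)).card := by
  classical
  refine (Finset.card_image_of_injOn fun e he e' he' h => ?_).symm
  have hd := (hf (mem_support_iff.mp he))
  have hd' := (hf (mem_support_iff.mp he'))
  rw [Finsupp.weight_apply, Finsupp.sum_fintype _ _ (fun _ => by simp)] at hd hd'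
  simp only [Pi.one_apply, smul_eq_mul, mul_one, Fin.sum_univ_three] at hd hd'
  simp only [Prod.mk.injEq] at h
  ext i
  fin_cases i
  · exact h.1
  · exact h.2
  · simp; omega

end DiagonalSupport

/-! ### §2 Counting: at most `6` monomials for three distinct eigenvalues -/

section CountDistinct

/-- **Three distinct eigenvalues ⇒ at most `6` monomials.** If `diag(λ₀, λ₁, λ₂) · f = f` for a
ternary quartic `f` with `λ₀, λ₁, λ₂` nonzero and pairwise distinct, then `f` has at most `6`
monomials: the `15` quartic monomials are covered by `6` cliques of the unit-transfer graph
(`{x₀⁴, x₀³x₁, x₀³x₂}`, `{x₀²x₁², x₀x₁³, x₀x₁²x₂}`, `{x₁⁴, x₁³x₂}`, `{x₀²x₁x₂, x₀²x₂², x₀x₁x₂²}`,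
`{x₁²x₂², x₁x₂³}`, `{x₀x₂³, x₂⁴}`), each meeting the support at most once.
[cite: BurgisserIkenmeyer2017, §7 (Appendix) Prop. 7.5] -/
theorem card_support_le_six_of_diagonal {f : MvPolynomial (Fin 3) ℂ} (hf : f.IsHomogeneous 4)
    {l₀ l₁ l₂ : ℂ} (h0 : l₀ ≠ 0) (h1 : l₁ ≠ 0) (h2 : l₂ ≠ 0) (h01 : l₀ ≠ l₁) (h02 : l₀ ≠ l₂)
    (h12 : l₁ ≠ l₂) (hT : linSubst (Fin 3) ℂ !![l₀, 0, 0; 0, l₁, 0; 0, 0, l₂] f = f) :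
    f.support.card ≤ 6 := by
  classical
  rw [card_support_eq_card_image hf]
  set A := f.support.image fun e : Fin 3 →₀ ℕ => (e 0, e 1) with hA
  -- the property of the image
  have hgood : ∀ x ∈ A, x.1 + x.2 ≤ 4 ∧ l₀ ^ x.1 * l₁ ^ x.2 * l₂ ^ (4 - x.1 - x.2) = 1 := by
    intro x hx
    obtain ⟨e, he, rfl⟩ := Finset.mem_image.mp hx
    obtain ⟨hpow, hdeg⟩ := pow_mul_pow_eq_one_of_diagonal hf hT he
    refine ⟨by simp only; omega, ?_⟩
    have h3 : 4 - e 0 - e 1 = e 2 := by omega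
    simp only [h3]
    exact hpow
  -- the six cliques
  let K₁ : Finset (ℕ × ℕ) := {(4, 0), (3, 1), (3, 0)}
  let K₂ : Finset (ℕ × ℕ) := {(2, 2), (1, 3), (1, 2)}
  let K₃ : Finset (ℕ × ℕ) := {(0, 4), (0, 3)}
  let K₄ : Finset (ℕ × ℕ) := {(2, 1), (2, 0), (1, 1)}
  let K₅ : Finset (ℕ × ℕ) := {(0, 2), (0, 1)}
  let K₆ : Finset (ℕ × ℕ) := {(1, 0), (0, 0)}
  have hcover : A ⊆ (A ∩ K₁) ∪ (A ∩ K₂) ∪ (A ∩ K₃) ∪ (A ∩ K₄) ∪ (A ∩ K₅) ∪ (A ∩ K₆) := by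
    intro x hx
    obtain ⟨hle, -⟩ := hgood x hx
    obtain ⟨a, b⟩ := x
    simp only at hle
    simp only [Finset.mem_union, Finset.mem_inter, hx, true_and, K₁, K₂, K₃, K₄, K₅, K₆,
      Finset.mem_insert, Finset.mem_singleton, Prod.mk.injEq]
    omega
  -- incompatible pairs (unit transfers)
  have G : ∀ x ∈ A, l₀ ^ x.1 * l₁ ^ x.2 * l₂ ^ (4 - x.1 - x.2) = 1 := fun x hx => (hgood x hx).2
  have n1 : ¬ ((4, 0) ∈ A ∧ (3, 1) ∈ A) := fun hh => h01 (eq_of_transfer_zero_one h0 h1 h2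
    (a := 3) (b := 0) (c := 0) (by simpa using G _ hh.1) (by simpa using G _ hh.2))
  have n2 : ¬ ((4, 0) ∈ A ∧ (3, 0) ∈ A) := fun hh => h02 (eq_of_transfer_zero_two h0 h1 h2
    (a := 3) (b := 0) (c := 0) (by simpa using G _ hh.1) (by simpa using G _ hh.2))
  have n3 : ¬ ((3, 1) ∈ A ∧ (3, 0) ∈ A) := fun hh => h12 (eq_of_transfer_one_two h0 h1 h2
    (a := 3) (b := 0) (c := 0) (by simpa using G _ hh.1) (by simpa using G _ hh.2))
  have n4 : ¬ ((2, 2) ∈ A ∧ (1, 3) ∈ A) := fun hh => h01 (eq_of_transfer_zero_one h0 h1 h2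
    (a := 1) (b := 2) (c := 0) (by simpa using G _ hh.1) (by simpa using G _ hh.2))
  have n5 : ¬ ((2, 2) ∈ A ∧ (1, 2) ∈ A) := fun hh => h02 (eq_of_transfer_zero_two h0 h1 h2
    (a := 1) (b := 2) (c := 0) (by simpa using G _ hh.1) (by simpa using G _ hh.2))
  have n6 : ¬ ((1, 3) ∈ A ∧ (1, 2) ∈ A) := fun hh => h12 (eq_of_transfer_one_two h0 h1 h2
    (a := 1) (b := 2) (c := 0) (by simpa using G _ hh.1) (by simpa using G _ hh.2))
  have n7 : ¬ ((0, 4) ∈ A ∧ (0, 3) ∈ A) := fun hh => h12 (eq_of_transfer_one_two h0 h1 h2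
    (a := 0) (b := 3) (c := 0) (by simpa using G _ hh.1) (by simpa using G _ hh.2))
  have n8 : ¬ ((2, 1) ∈ A ∧ (2, 0) ∈ A) := fun hh => h12 (eq_of_transfer_one_two h0 h1 h2
    (a := 2) (b := 0) (c := 1) (by simpa using G _ hh.1) (by simpa using G _ hh.2))
  have n9 : ¬ ((2, 1) ∈ A ∧ (1, 1) ∈ A) := fun hh => h02 (eq_of_transfer_zero_two h0 h1 h2
    (a := 1) (b := 1) (c := 1) (by simpa using G _ hh.1) (by simpa using G _ hh.2))
  have n10 : ¬ ((2, 0) ∈ A ∧ (1, 1) ∈ A) := fun hh => h01 (eq_of_transfer_zero_one h0 h1 h2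
    (a := 1) (b := 0) (c := 2) (by simpa using G _ hh.1) (by simpa using G _ hh.2))
  have n11 : ¬ ((0, 2) ∈ A ∧ (0, 1) ∈ A) := fun hh => h12 (eq_of_transfer_one_two h0 h1 h2
    (a := 0) (b := 1) (c := 2) (by simpa using G _ hh.1) (by simpa using G _ hh.2))
  have n12 : ¬ ((1, 0) ∈ A ∧ (0, 0) ∈ A) := fun hh => h02 (eq_of_transfer_zero_two h0 h1 h2
    (a := 0) (b := 0) (c := 3) (by simpa using G _ hh.1) (by simpa using G _ hh.2))
  -- at most one support monomial per clique
  have hK₁ : (A ∩ K₁).card ≤ 1 := by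
    refine Finset.card_le_one.mpr fun x hx y hy => ?_
    simp only [Finset.mem_inter, K₁, Finset.mem_insert, Finset.mem_singleton] at hx hy
    obtain ⟨hxA, hx⟩ := hx
    obtain ⟨hyA, hy⟩ := hy
    rcases hx with rfl | rfl | rfl
    · rcases hy with rfl | rfl | rfl
      · rfl
      · exact absurd ⟨hxA, hyA⟩ n1
      · exact absurd ⟨hxA, hyA⟩ n2
    · rcases hy with rfl | rfl | rfl
      · exact absurd ⟨hyA, hxA⟩ n1
      · rfl
      · exact absurd ⟨hxA, hyA⟩ n3
    · rcases hy with rfl | rfl | rfl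
      · exact absurd ⟨hyA, hxA⟩ n2
      · exact absurd ⟨hyA, hxA⟩ n3
      · rfl
  have hK₂ : (A ∩ K₂).card ≤ 1 := by
    refine Finset.card_le_one.mpr fun x hx y hy => ?_
    simp only [Finset.mem_inter, K₂, Finset.mem_insert, Finset.mem_singleton] at hx hy
    obtain ⟨hxA, hx⟩ := hx
    obtain ⟨hyA, hy⟩ := hy
    rcases hx with rfl | rfl | rfl
    · rcases hy with rfl | rfl | rfl
      · rfl
      · exact absurd ⟨hxA, hyA⟩ n4
      · exact absurd ⟨hxA, hyA⟩ n5
    · rcases hy with rfl | rfl | rfl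
      · exact absurd ⟨hyA, hxA⟩ n4
      · rfl
      · exact absurd ⟨hxA, hyA⟩ n6
    · rcases hy with rfl | rfl | rfl
      · exact absurd ⟨hyA, hxA⟩ n5
      · exact absurd ⟨hyA, hxA⟩ n6
      · rfl
  have hK₃ : (A ∩ K₃).card ≤ 1 := by
    refine Finset.card_le_one.mpr fun x hx y hy => ?_
    simp only [Finset.mem_inter, K₃, Finset.mem_insert, Finset.mem_singleton] at hx hy
    obtain ⟨hxA, hx⟩ := hx
    obtain ⟨hyA, hy⟩ := hy
    rcases hx with rfl | rfl
    · rcases hy with rfl | rfl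
      · rfl
      · exact absurd ⟨hxA, hyA⟩ n7
    · rcases hy with rfl | rfl
      · exact absurd ⟨hyA, hxA⟩ n7
      · rfl
  have hK₄ : (A ∩ K₄).card ≤ 1 := by
    refine Finset.card_le_one.mpr fun x hx y hy => ?_
    simp only [Finset.mem_inter, K₄, Finset.mem_insert, Finset.mem_singleton] at hx hy
    obtain ⟨hxA, hx⟩ := hx
    obtain ⟨hyA, hy⟩ := hy
    rcases hx with rfl | rfl | rfl
    · rcases hy with rfl | rfl | rfl
      · rfl
      · exact absurd ⟨hxA, hyA⟩ n8
      · exact absurd ⟨hxA, hyA⟩ n9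
    · rcases hy with rfl | rfl | rfl
      · exact absurd ⟨hyA, hxA⟩ n8
      · rfl
      · exact absurd ⟨hxA, hyA⟩ n10
    · rcases hy with rfl | rfl | rfl
      · exact absurd ⟨hyA, hxA⟩ n9
      · exact absurd ⟨hyA, hxA⟩ n10
      · rfl
  have hK₅ : (A ∩ K₅).card ≤ 1 := by
    refine Finset.card_le_one.mpr fun x hx y hy => ?_
    simp only [Finset.mem_inter, K₅, Finset.mem_insert, Finset.mem_singleton] at hx hy
    obtain ⟨hxA, hx⟩ := hx
    obtain ⟨hyA, hy⟩ := hy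
    rcases hx with rfl | rfl
    · rcases hy with rfl | rfl
      · rfl
      · exact absurd ⟨hxA, hyA⟩ n11
    · rcases hy with rfl | rfl
      · exact absurd ⟨hyA, hxA⟩ n11
      · rfl
  have hK₆ : (A ∩ K₆).card ≤ 1 := by
    refine Finset.card_le_one.mpr fun x hx y hy => ?_
    simp only [Finset.mem_inter, K₆, Finset.mem_insert, Finset.mem_singleton] at hx hy
    obtain ⟨hxA, hx⟩ := hx
    obtain ⟨hyA, hy⟩ := hy
    rcases hx with rfl | rfl
    · rcases hy with rfl | rfl
      · rfl
      · exact absurd ⟨hxA, hyA⟩ n12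
    · rcases hy with rfl | rfl
      · exact absurd ⟨hyA, hxA⟩ n12
      · rfl
  -- add up
  have u := Finset.card_le_card hcover
  have u1 := Finset.card_union_le (A ∩ K₁) (A ∩ K₂)
  have u2 := Finset.card_union_le (A ∩ K₁ ∪ A ∩ K₂) (A ∩ K₃)
  have u3 := Finset.card_union_le (A ∩ K₁ ∪ A ∩ K₂ ∪ A ∩ K₃) (A ∩ K₄)
  have u4 := Finset.card_union_le (A ∩ K₁ ∪ A ∩ K₂ ∪ A ∩ K₃ ∪ A ∩ K₄) (A ∩ K₅)
  have u5 := Finset.card_union_le (A ∩ K₁ ∪ A ∩ K₂ ∪ A ∩ K₃ ∪ A ∩ K₄ ∪ A ∩ K₅) (A ∩ K₆)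
  omega

end CountDistinct

/-! ### §3 Counting: at most `9` monomials for `diag(λ, λ, μ)`, `λ ≠ μ` -/

section CountPair

/-- **Eigenvalues `(λ, λ, μ)`, `λ ≠ μ` ⇒ at most `9` monomials.** If `diag(λ, λ, μ) · f = f` for a
ternary quartic `f` (`λ, μ ≠ 0`, `λ ≠ μ`) then `f` has at most `9` monomials: the `15` quartic
monomials are covered by `6` unit-transfer edges `x^e ↔ x^e x₂/x₀` and `3` singletons, each edge
meeting the support at most once. [cite: BurgisserIkenmeyer2017, §7 (Appendix) Prop. 7.5] -/
theorem card_support_le_nine_of_diagonal {f : MvPolynomial (Fin 3) ℂ} (hf : f.IsHomogeneous 4)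
    {l μ : ℂ} (hl : l ≠ 0) (hμ : μ ≠ 0) (hlμ : l ≠ μ)
    (hT : linSubst (Fin 3) ℂ !![l, 0, 0; 0, l, 0; 0, 0, μ] f = f) :
    f.support.card ≤ 9 := by
  classical
  rw [card_support_eq_card_image hf]
  set A := f.support.image fun e : Fin 3 →₀ ℕ => (e 0, e 1) with hA
  have hgood : ∀ x ∈ A, x.1 + x.2 ≤ 4 ∧ l ^ x.1 * l ^ x.2 * μ ^ (4 - x.1 - x.2) = 1 := by
    intro x hx
    obtain ⟨e, he, rfl⟩ := Finset.mem_image.mp hx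
    obtain ⟨hpow, hdeg⟩ := pow_mul_pow_eq_one_of_diagonal hf hT he
    refine ⟨by simp only; omega, ?_⟩
    have h3 : 4 - e 0 - e 1 = e 2 := by omega
    simp only [h3]
    exact hpow
  let E₁ : Finset (ℕ × ℕ) := {(4, 0), (3, 0)}
  let E₂ : Finset (ℕ × ℕ) := {(3, 1), (2, 1)}
  let E₃ : Finset (ℕ × ℕ) := {(2, 2), (1, 2)}
  let E₄ : Finset (ℕ × ℕ) := {(1, 3), (0, 3)}
  let E₅ : Finset (ℕ × ℕ) := {(0, 4)}
  let E₆ : Finset (ℕ × ℕ) := {(2, 0), (1, 0)}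
  let E₇ : Finset (ℕ × ℕ) := {(1, 1), (0, 1)}
  let E₈ : Finset (ℕ × ℕ) := {(0, 2)}
  let E₉ : Finset (ℕ × ℕ) := {(0, 0)}
  have hcover : A ⊆ (A ∩ E₁) ∪ (A ∩ E₂) ∪ (A ∩ E₃) ∪ (A ∩ E₄) ∪ (A ∩ E₅) ∪ (A ∩ E₆) ∪ (A ∩ E₇) ∪
      (A ∩ E₈) ∪ (A ∩ E₉) := by
    intro x hx
    obtain ⟨hle, -⟩ := hgood x hx
    obtain ⟨a, b⟩ := x
    simp only at hle
    simp only [Finset.mem_union, Finset.mem_inter, hx, true_and, E₁, E₂, E₃, E₄, E₅, E₆, E₇, E₈, E₉,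
      Finset.mem_insert, Finset.mem_singleton, Prod.mk.injEq]
    omega
  have G : ∀ x ∈ A, l ^ x.1 * l ^ x.2 * μ ^ (4 - x.1 - x.2) = 1 := fun x hx => (hgood x hx).2
  have m1 : ¬ ((4, 0) ∈ A ∧ (3, 0) ∈ A) := fun hh => hlμ (eq_of_transfer_zero_two hl hl hμ
    (a := 3) (b := 0) (c := 0) (by simpa using G _ hh.1) (by simpa using G _ hh.2))
  have m2 : ¬ ((3, 1) ∈ A ∧ (2, 1) ∈ A) := fun hh => hlμ (eq_of_transfer_zero_two hl hl hμ
    (a := 2) (b := 1) (c := 0) (by simpa using G _ hh.1) (by simpa using G _ hh.2))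
  have m3 : ¬ ((2, 2) ∈ A ∧ (1, 2) ∈ A) := fun hh => hlμ (eq_of_transfer_zero_two hl hl hμ
    (a := 1) (b := 2) (c := 0) (by simpa using G _ hh.1) (by simpa using G _ hh.2))
  have m4 : ¬ ((1, 3) ∈ A ∧ (0, 3) ∈ A) := fun hh => hlμ (eq_of_transfer_zero_two hl hl hμ
    (a := 0) (b := 3) (c := 0) (by simpa using G _ hh.1) (by simpa using G _ hh.2))
  have m5 : ¬ ((2, 0) ∈ A ∧ (1, 0) ∈ A) := fun hh => hlμ (eq_of_transfer_zero_two hl hl hμ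
    (a := 1) (b := 0) (c := 2) (by simpa using G _ hh.1) (by simpa using G _ hh.2))
  have m6 : ¬ ((1, 1) ∈ A ∧ (0, 1) ∈ A) := fun hh => hlμ (eq_of_transfer_zero_two hl hl hμ
    (a := 0) (b := 1) (c := 2) (by simpa using G _ hh.1) (by simpa using G _ hh.2))
  have hE₁ : (A ∩ E₁).card ≤ 1 := by
    refine Finset.card_le_one.mpr fun x hx y hy => ?_
    simp only [Finset.mem_inter, E₁, Finset.mem_insert, Finset.mem_singleton] at hx hy
    obtain ⟨hxA, hx⟩ := hx
    obtain ⟨hyA, hy⟩ := hy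
    rcases hx with rfl | rfl
    · rcases hy with rfl | rfl
      · rfl
      · exact absurd ⟨hxA, hyA⟩ m1
    · rcases hy with rfl | rfl
      · exact absurd ⟨hyA, hxA⟩ m1
      · rfl
  have hE₂ : (A ∩ E₂).card ≤ 1 := by
    refine Finset.card_le_one.mpr fun x hx y hy => ?_
    simp only [Finset.mem_inter, E₂, Finset.mem_insert, Finset.mem_singleton] at hx hy
    obtain ⟨hxA, hx⟩ := hx
    obtain ⟨hyA, hy⟩ := hy
    rcases hx with rfl | rfl
    · rcases hy with rfl | rfl
      · rfl
      · exact absurd ⟨hxA, hyA⟩ m2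
    · rcases hy with rfl | rfl
      · exact absurd ⟨hyA, hxA⟩ m2
      · rfl
  have hE₃ : (A ∩ E₃).card ≤ 1 := by
    refine Finset.card_le_one.mpr fun x hx y hy => ?_
    simp only [Finset.mem_inter, E₃, Finset.mem_insert, Finset.mem_singleton] at hx hy
    obtain ⟨hxA, hx⟩ := hx
    obtain ⟨hyA, hy⟩ := hy
    rcases hx with rfl | rfl
    · rcases hy with rfl | rfl
      · rfl
      · exact absurd ⟨hxA, hyA⟩ m3
    · rcases hy with rfl | rfl
      · exact absurd ⟨hyA, hxA⟩ m3
      · rfl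
  have hE₄ : (A ∩ E₄).card ≤ 1 := by
    refine Finset.card_le_one.mpr fun x hx y hy => ?_
    simp only [Finset.mem_inter, E₄, Finset.mem_insert, Finset.mem_singleton] at hx hy
    obtain ⟨hxA, hx⟩ := hx
    obtain ⟨hyA, hy⟩ := hy
    rcases hx with rfl | rfl
    · rcases hy with rfl | rfl
      · rfl
      · exact absurd ⟨hxA, hyA⟩ m4
    · rcases hy with rfl | rfl
      · exact absurd ⟨hyA, hxA⟩ m4
      · rfl
  have hE₆ : (A ∩ E₆).card ≤ 1 := by
    refine Finset.card_le_one.mpr fun x hx y hy => ?_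
    simp only [Finset.mem_inter, E₆, Finset.mem_insert, Finset.mem_singleton] at hx hy
    obtain ⟨hxA, hx⟩ := hx
    obtain ⟨hyA, hy⟩ := hy
    rcases hx with rfl | rfl
    · rcases hy with rfl | rfl
      · rfl
      · exact absurd ⟨hxA, hyA⟩ m5
    · rcases hy with rfl | rfl
      · exact absurd ⟨hyA, hxA⟩ m5
      · rfl
  have hE₇ : (A ∩ E₇).card ≤ 1 := by
    refine Finset.card_le_one.mpr fun x hx y hy => ?_
    simp only [Finset.mem_inter, E₇, Finset.mem_insert, Finset.mem_singleton] at hx hy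
    obtain ⟨hxA, hx⟩ := hx
    obtain ⟨hyA, hy⟩ := hy
    rcases hx with rfl | rfl
    · rcases hy with rfl | rfl
      · rfl
      · exact absurd ⟨hxA, hyA⟩ m6
    · rcases hy with rfl | rfl
      · exact absurd ⟨hyA, hxA⟩ m6
      · rfl
  have hE₅ : (A ∩ E₅).card ≤ 1 := (Finset.card_le_card Finset.inter_subset_right).trans (by simp [E₅])
  have hE₈ : (A ∩ E₈).card ≤ 1 := (Finset.card_le_card Finset.inter_subset_right).trans (by simp [E₈])
  have hE₉ : (A ∩ E₉).card ≤ 1 := (Finset.card_le_card Finset.inter_subset_right).trans (by simp [E₉])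
  have u := Finset.card_le_card hcover
  have u1 := Finset.card_union_le (A ∩ E₁) (A ∩ E₂)
  have u2 := Finset.card_union_le (A ∩ E₁ ∪ A ∩ E₂) (A ∩ E₃)
  have u3 := Finset.card_union_le (A ∩ E₁ ∪ A ∩ E₂ ∪ A ∩ E₃) (A ∩ E₄)
  have u4 := Finset.card_union_le (A ∩ E₁ ∪ A ∩ E₂ ∪ A ∩ E₃ ∪ A ∩ E₄) (A ∩ E₅)
  have u5 := Finset.card_union_le (A ∩ E₁ ∪ A ∩ E₂ ∪ A ∩ E₃ ∪ A ∩ E₄ ∪ A ∩ E₅) (A ∩ E₆)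
  have u6 := Finset.card_union_le (A ∩ E₁ ∪ A ∩ E₂ ∪ A ∩ E₃ ∪ A ∩ E₄ ∪ A ∩ E₅ ∪ A ∩ E₆) (A ∩ E₇)
  have u7 := Finset.card_union_le (A ∩ E₁ ∪ A ∩ E₂ ∪ A ∩ E₃ ∪ A ∩ E₄ ∪ A ∩ E₅ ∪ A ∩ E₆ ∪ A ∩ E₇)
    (A ∩ E₈)
  have u8 := Finset.card_union_le
    (A ∩ E₁ ∪ A ∩ E₂ ∪ A ∩ E₃ ∪ A ∩ E₄ ∪ A ∩ E₅ ∪ A ∩ E₆ ∪ A ∩ E₇ ∪ A ∩ E₈) (A ∩ E₉)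
  omega

end CountPair

end Literature.Computability.AlgebraicComplexity
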